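import Summits.ResolutionOfSingularities.ResolutionOfSingularities.Theorems.EquisingularLiftEquisingularLiftNatHomRankOneClass
import Literature.AlgebraicGeometry.Modules.DeterminantCocycleExact
import HarnessLib

/-!
# [OURS · L1 W4.5(b) · EL♮(3) (L) brick C2, sub-brick B2] The Q-side classes: `[Q] = [F]·[L₀]⁻¹` and `[𝓗om(L₀, Q)] = [F]·[L₀]⁻²`
# in `Ȟ¹(X, 𝒪_X^×)` for a short exact sequence `0 → L₀ → F → Q → 0` with `L₀`, `Q` of rank one

Cell res-hironaka, LADDER-RESOLUTION rung L, slot W4.5(b), crux chain w45b: EL♮(3) = stmt-ResolutionOfSingularities-20148, S6 (L) brick C2 of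
`Tower.hLift_of_bricks` (res-L1-w45b-stub-4 skeleton; res-type-027 g15 C2-CENSUS f661334467642d74 §2, sub-brick **B2 «Q-side classes»**;
res-L1-w45b-plan-1 DESK RULING C2 2026-08-27T23:27:38Z «B2 → res-D-pv-036»). Seat res-D-pv-036 g11 (on-call supplier). `--supports
stmt-ResolutionOfSingularities-20148 --as helper`. OURS; NOT a statement of any manuscript; AI-written, weaker than expert review. Definition-free; standard
axioms.

In the Čech Picard group `CechPic X` (tree `Modules/UnitCocycle`, a commutative group) with the determinant class `detClass` (tree
`Modules/DeterminantCocycle`):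
* `detClass_X₃_eq_of_shortExact` — for `0 → E₁ → E₂ → E₃ → 0` short exact with all three finite locally free: `[E₃] = [E₂]·[E₁]⁻¹` (and
  `detClass_X₁_eq_of_shortExact`: `[E₁] = [E₂]·[E₃]⁻¹`) — the group-algebra forms of the tree's `detClass_mul_of_shortExact`;
* **`detClass_sheafHom_eq_of_shortExact`** — if moreover `E₁ = L₀` and `E₃ = Q` have rank one: `[𝓗om(L₀, Q)] = [F]·([L₀]²)⁻¹`
  (res-type-027's K1 `detClass_sheafHom_of_hasRank_one`: `[𝓗om(L₀, Q)] = [Q]·[L₀]⁻¹`).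
[cite: Hartshorne1977, II Ex. 5.16 (d), II Ex. 5.1 (b)] [folklore]
-/

noncomputable section

open CategoryTheory AlgebraicGeometry Opposite TopologicalSpace
open Literature.AlgebraicGeometry.Modules Literature.AlgebraicGeometry.Motives

set_option linter.dupNamespace false

namespace Summit.ResolutionOfSingularities.ResolutionOfSingularities.Cruxes.EquisingularLiftNat.Sections

universe u

variable {X : Scheme.{u}}

/-- **`[E₃] = [E₂]·[E₁]⁻¹`** for a short exact sequence of finite locally free modules. [cite: Hartshorne1977, II Ex. 5.16 (d)] [folklore] -/
theorem detClass_X₃_eq_of_shortExact {S : ShortComplex X.Modules} (hS : S.ShortExact) (h₁ : IsFiniteLocallyFree S.X₁)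
    (h₂ : IsFiniteLocallyFree S.X₂) (h₃ : IsFiniteLocallyFree S.X₃) :
    detClass h₃ = detClass h₂ * (detClass h₁)⁻¹ := by
  rw [detClass_mul_of_shortExact hS h₁ h₂ h₃, mul_comm (detClass h₁), mul_assoc, mul_inv_cancel, mul_one]

/-- **`[E₁] = [E₂]·[E₃]⁻¹`** for a short exact sequence of finite locally free modules. [cite: Hartshorne1977, II Ex. 5.16 (d)] [folklore] -/
theorem detClass_X₁_eq_of_shortExact {S : ShortComplex X.Modules} (hS : S.ShortExact) (h₁ : IsFiniteLocallyFree S.X₁)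
    (h₂ : IsFiniteLocallyFree S.X₂) (h₃ : IsFiniteLocallyFree S.X₃) :
    detClass h₁ = detClass h₂ * (detClass h₃)⁻¹ := by
  rw [detClass_mul_of_shortExact hS h₁ h₂ h₃, mul_assoc, mul_inv_cancel, mul_one]

/-- **B2: `[𝓗om(L₀, Q)] = [F]·([L₀]²)⁻¹`** for `0 → L₀ → F → Q → 0` short exact with `L₀`, `Q` of rank one (all finite locally free):
K1 (`detClass_sheafHom_of_hasRank_one`: `[𝓗om(L₀, Q)] = [Q]·[L₀]⁻¹`) and `[Q] = [F]·[L₀]⁻¹`. [cite: Hartshorne1977, II Ex. 5.16 (d), II Ex. 5.1 (b)]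
[folklore] -/
theorem detClass_sheafHom_eq_of_shortExact {S : ShortComplex X.Modules} (hS : S.ShortExact)
    (hL : HasRank S.X₁ 1) (hQ : HasRank S.X₃ 1)
    (h₁ : IsFiniteLocallyFree S.X₁) (h₂ : IsFiniteLocallyFree S.X₂) (h₃ : IsFiniteLocallyFree S.X₃)
    (hH : IsFiniteLocallyFree (sheafHom S.X₁ S.X₃)) :
    detClass hH = detClass h₂ * (detClass h₁ ^ 2)⁻¹ := by
  rw [(detClass_sheafHom_of_hasRank_one hL hQ h₁ h₃ hH).2, detClass_X₃_eq_of_shortExact hS h₁ h₂ h₃, pow_two, mul_inv,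
    mul_assoc]

/-- B2, variant without the `IsFiniteLocallyFree (sheafHom _ _)` argument (supplied by K1's `isFiniteLocallyFree_sheafHom_of_hasRank_one`).
[folklore] -/
theorem detClass_sheafHom_eq_of_shortExact' {S : ShortComplex X.Modules} (hS : S.ShortExact)
    (hL : HasRank S.X₁ 1) (hQ : HasRank S.X₃ 1)
    (h₁ : IsFiniteLocallyFree S.X₁) (h₂ : IsFiniteLocallyFree S.X₂) (h₃ : IsFiniteLocallyFree S.X₃) :
    detClass (isFiniteLocallyFree_sheafHom_of_hasRank_one hL hQ) = detClass h₂ * (detClass h₁ ^ 2)⁻¹ :=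
  detClass_sheafHom_eq_of_shortExact hS hL hQ h₁ h₂ h₃ _

/-- **`𝓗om(L₀, Q)` has rank one** in this situation (restated from K1 for the C2 assembly). [folklore] -/
theorem hasRank_sheafHom_one_of_shortExact {S : ShortComplex X.Modules} (hL : HasRank S.X₁ 1) (hQ : HasRank S.X₃ 1)
    (h₁ : IsFiniteLocallyFree S.X₁) (h₃ : IsFiniteLocallyFree S.X₃) :
    HasRank (sheafHom S.X₁ S.X₃) 1 :=
  (detClass_sheafHom_of_hasRank_one hL hQ h₁ h₃ (isFiniteLocallyFree_sheafHom_of_hasRank_one hL hQ)).1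

end Summit.ResolutionOfSingularities.ResolutionOfSingularities.Cruxes.EquisingularLiftNat.Sections

end
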